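import Summits.Ventures.Crystal3D.Theorems.StickyWulffConstantGenericWallFloorStackWalkWordSepFarTwo
import HarnessLib

/-!
# Word helpers for the ray cross analysis: junction cancellation and transported mirrors
# (crux `GenericWallFloor`, stmt-Ventures-19480, line `WallLedgerG`)

HONEST FRAMING. Venture `Summits/Ventures/Crystal3D` (cell `crystal3d-full`), helper `--supports` the crux
`GenericWallFloor` of `route-Ventures-StickyWulffConstant`, REGISTERED line `WallLedgerG`, open stub
`stub_twoSlabAdhesion`.  Pure word/list lemmas for `…StackWalkRayCross`; rung credit only; F-C1 not moved; NOT the crux.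

* `junction_reduce` — appending a word `γ` in front of a word `κ`, the mirrors cancelling at the junction can be removed:
  for some `j`, the last `j` letters of `γ` mirror the first `j` letters of `κ` in reverse order, the frame of `γ ++ κ`
  is that of `γ.take (|γ| − j) ++ κ.drop j`, and THIS junction no longer cancels;
* `reflection_map_eq_iff` / `map_reflection_map_eq_iff` — mirrors of unit letters transported by an isometry agree iff
  the original mirrors agree;
* `reflection_ne_of_inner_third` / `inner_third_of_reflection_ne` — consecutive chain letters have different mirrors, and
  model menu normals with different mirrors meet at `±1/3`.
-/

noncomputable section

namespace Summit.Ventures.Crystal3D.Theorems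

open Summit.Ventures.Crystal3D Finset
open scoped InnerProductSpace

/-! ### Word helpers -/

/-- **Junction cancellation.**  Appending a word `γ` in front of `κ`, the mirrors cancelling at the junction can be
removed: for some `j`, the last `j` letters of `γ` mirror the first `j` letters of `κ` in reverse order, the frame of
`γ ++ κ` is that of `γ.take (|γ| − j) ++ κ.drop j`, and this shorter junction does not cancel. -/
theorem junction_reduce (B : EuclideanSpace ℝ (Fin 3) ≃ₗᵢ[ℝ] EuclideanSpace ℝ (Fin 3)) :
    ∀ (n : ℕ) (γ κ : List (EuclideanSpace ℝ (Fin 3))), γ.length = n →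
      ∃ j : ℕ, j ≤ κ.length ∧ j ≤ γ.length ∧
        wordFrame B (γ ++ κ) = wordFrame B (γ.take (γ.length - j) ++ κ.drop j) ∧
        (γ.drop (γ.length - j)).map (fun μ => (ℝ ∙ μ)ᗮ.reflection) =
          ((κ.take j).reverse).map (fun μ => (ℝ ∙ μ)ᗮ.reflection) ∧
        ∀ x ∈ (γ.take (γ.length - j)).getLast?, ∀ y ∈ (κ.drop j).head?, (ℝ ∙ x)ᗮ.reflection ≠ (ℝ ∙ y)ᗮ.reflection
  | 0, γ, κ, hγ => by
    have hγ0 : γ = [] := List.eq_nil_of_length_eq_zero hγ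
    subst hγ0
    exact ⟨0, Nat.zero_le _, le_rfl, rfl, by simp, fun x hx => by simp at hx⟩
  | n + 1, γ, κ, hγ => by
    obtain ⟨γ₀, g, rfl⟩ : ∃ γ₀ g, γ = γ₀ ++ [g] := by
      rcases List.eq_nil_or_concat γ with h | ⟨L, b, h⟩
      · subst h; simp at hγ
      · exact ⟨L, b, by rw [h, List.concat_eq_append]⟩
    have hγ₀ : γ₀.length = n := by rw [List.length_append, List.length_singleton] at hγ; omega
    have htake : List.take (γ₀.length + 1) (γ₀ ++ [g]) = γ₀ ++ [g] :=
      List.take_of_length_le (by rw [List.length_append, List.length_singleton])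
    cases κ with
    | nil =>
      refine ⟨0, le_rfl, Nat.zero_le _, by simp [htake], by simp, fun x _ y hy => by simp at hy⟩
    | cons m κ₀ =>
      by_cases hgm : (ℝ ∙ g)ᗮ.reflection = (ℝ ∙ m)ᗮ.reflection
      · obtain ⟨j₀, hjκ, hjγ, hwf, hcan, hnc⟩ := junction_reduce B n γ₀ κ₀ hγ₀
        refine ⟨j₀ + 1, by rw [List.length_cons]; omega, by rw [List.length_append, List.length_singleton]; omega,
          ?_, ?_, ?_⟩
        · have h1 : wordFrame B (γ₀ ++ [g] ++ m :: κ₀) = wordFrame B (γ₀ ++ κ₀) := by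
            rw [List.append_assoc, List.singleton_append]; exact wordFrame_append_cons_cons_cancel B γ₀ hgm κ₀
          rw [h1, hwf, List.length_append, List.length_singleton, List.drop_succ_cons,
            show γ₀.length + 1 - (j₀ + 1) = γ₀.length - j₀ by omega, List.take_append_of_le_length (by omega)]
        · rw [List.length_append, List.length_singleton, show γ₀.length + 1 - (j₀ + 1) = γ₀.length - j₀ by omega,
            List.drop_append_of_le_length (by omega), List.map_append, hcan, List.take_succ_cons, List.reverse_cons,
            List.map_append]
          simp [hgm]
        · rw [List.length_append, List.length_singleton, show γ₀.length + 1 - (j₀ + 1) = γ₀.length - j₀ by omega,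
            List.take_append_of_le_length (by omega), List.drop_succ_cons]
          exact hnc
      · refine ⟨0, Nat.zero_le _, Nat.zero_le _, by simp [htake], by simp, fun x hx y hy => ?_⟩
        rw [Nat.sub_zero, List.take_length, List.getLast?_append, List.getLast?_singleton, Option.some_or,
          Option.mem_def, Option.some.injEq] at hx
        rw [List.drop_zero, List.head?_cons, Option.mem_def, Option.some.injEq] at hy
        rw [← hx, ← hy]; exact hgm

/-- Mirrors of letters transported by an isometry agree iff the original mirrors agree (unit letters). -/
theorem reflection_map_eq_iff (S : EuclideanSpace ℝ (Fin 3) ≃ₗᵢ[ℝ] EuclideanSpace ℝ (Fin 3)) {x y : EuclideanSpace ℝ (Fin 3)}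
    (hx : ‖x‖ = 1) (hy : ‖y‖ = 1) :
    (ℝ ∙ S x)ᗮ.reflection = (ℝ ∙ S y)ᗮ.reflection ↔ (ℝ ∙ x)ᗮ.reflection = (ℝ ∙ y)ᗮ.reflection := by
  have hSx : ‖S x‖ = 1 := by rw [LinearIsometryEquiv.norm_map, hx]
  have hSy : ‖S y‖ = 1 := by rw [LinearIsometryEquiv.norm_map, hy]
  constructor
  · intro h
    rcases eq_or_eq_neg_of_reflection_eq hSx hSy h with h' | h'
    · rw [S.injective h']
    · rw [← map_neg] at h'; rw [S.injective h', reflection_neg_eq hy]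
  · intro h
    rcases eq_or_eq_neg_of_reflection_eq hx hy h with h' | h'
    · rw [h']
    · rw [h', map_neg, reflection_neg_eq hSy]

/-- List version of `reflection_map_eq_iff`. -/
theorem map_reflection_map_eq_iff (S : EuclideanSpace ℝ (Fin 3) ≃ₗᵢ[ℝ] EuclideanSpace ℝ (Fin 3)) :
    ∀ (xs ys : List (EuclideanSpace ℝ (Fin 3))), (∀ x ∈ xs, ‖x‖ = 1) → (∀ y ∈ ys, ‖y‖ = 1) →
      ((xs.map S).map (fun μ => (ℝ ∙ μ)ᗮ.reflection) = (ys.map S).map (fun μ => (ℝ ∙ μ)ᗮ.reflection) ↔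
        xs.map (fun μ => (ℝ ∙ μ)ᗮ.reflection) = ys.map (fun μ => (ℝ ∙ μ)ᗮ.reflection))
  | [], [], _, _ => by simp
  | [], _ :: _, _, _ => by simp
  | _ :: _, [], _, _ => by simp
  | x :: xs, y :: ys, hx, hy => by
    simp only [List.map_cons, List.cons.injEq]
    rw [reflection_map_eq_iff S (hx x List.mem_cons_self) (hy y List.mem_cons_self),
      map_reflection_map_eq_iff S xs ys (fun a ha => hx a (List.mem_cons_of_mem x ha))
        (fun a ha => hy a (List.mem_cons_of_mem y ha))]

/-- Letters of a reduced chain word at consecutive positions have different mirrors. -/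
theorem reflection_ne_of_inner_third {x y : EuclideanSpace ℝ (Fin 3)} (hx : ‖x‖ = 1) (hy : ‖y‖ = 1)
    (h : ⟪x, y⟫_ℝ = 1 / 3 ∨ ⟪x, y⟫_ℝ = -1 / 3) : (ℝ ∙ x)ᗮ.reflection ≠ (ℝ ∙ y)ᗮ.reflection := by
  intro hR
  rcases eq_or_eq_neg_of_reflection_eq hx hy hR with h' | h'
  · rw [h', real_inner_self_eq_norm_sq, hy] at h; norm_num at h
  · rw [h', inner_neg_left, real_inner_self_eq_norm_sq, hy] at h; norm_num at h

/-- Two unit model menu normals with different mirrors meet at `±1/3`. -/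
theorem inner_third_of_reflection_ne {x y : EuclideanSpace ℝ (Fin 3)}
    (hx : ‖x‖ = 1 ∧ ∀ w ∈ fccSlots, ⟪w, x⟫_ℝ = 0 ∨ ⟪w, x⟫_ℝ = Real.sqrt (2 / 3) ∨ ⟪w, x⟫_ℝ = -Real.sqrt (2 / 3))
    (hy : ‖y‖ = 1 ∧ ∀ w ∈ fccSlots, ⟪w, y⟫_ℝ = 0 ∨ ⟪w, y⟫_ℝ = Real.sqrt (2 / 3) ∨ ⟪w, y⟫_ℝ = -Real.sqrt (2 / 3))
    (hR : (ℝ ∙ x)ᗮ.reflection ≠ (ℝ ∙ y)ᗮ.reflection) : ⟪x, y⟫_ℝ = 1 / 3 ∨ ⟪x, y⟫_ℝ = -1 / 3 := by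
  rcases inner_modelMenu hx.1 hy.1 hx.2 hy.2 with h | h | h | h
  · exact absurd (by rw [(inner_eq_one_iff_of_norm_eq_one (𝕜 := ℝ) hx.1 hy.1).1 h]) hR
  · exact absurd (by rw [eq_neg_of_inner_eq_neg_one' hx.1 hy.1 h, reflection_neg_eq hx.1]) hR
  · exact Or.inl h
  · exact Or.inr h

end Summit.Ventures.Crystal3D.Theorems

end
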